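import Summits.BirchSwinnertonDyer.BirchSwinnertonDyer.Theorems.Rank1ResidualX9Defs
import Literature.NumberTheory.EllipticCurves.SemistableModPImageIrreducibleProofs
import Literature.NumberTheory.EllipticCurves.ZpExtension
import HarnessLib

/-!
# K6 crux `MuTransferX9` (stmt-BirchSwinnertonDyer-19276): the X9-image input (F2)/(F8) of
# MU-TRANSFER-PROOF — `ℚ(E[p]) ∩ ℚ_∞ = ℚ`, i.e. `Γ_ℚ ↠ Ḡ × ℤ_p`, and a TOPOLOGICAL GENERATOR
# `γ₀` of any `ℤ_p`-extension FIXING `E[p]` — KERNEL, from `p ∤ #ρ̄_{E,p}(Γ_ℚ)` alone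

HONEST FRAMING (cell `b2b-bsdres`, X9 prover lineage; verbatim): the cell deletes COMBINATION-SHAPED
residual classes of the rank-≤1 BSD formula from PUBLISHED theorems only and TYPES the
construction-shaped remainder; this is not "finishing BSD".  Theorems only (no definition, no named
fact, no `sorry`); nothing is asserted about any curve beyond what the kernel proves; class X9 stays
TYPED at class level; no pair, count, mark or tier word moves.  Helper file
(`--supports stmt-BirchSwinnertonDyer-19276 --as helper`): it closes no stub and no item.

WHAT IT SERVES.  The cell `bsd-smallim`'s paper proof of the K6 crux `MuTransferX9` (Kato's
μ-transfer on class X9 without Kato's surjectivity hypothesis; `HOME/koly/MU-TRANSFER-PROOF.md`,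
Theorem A) uses, as its inputs (F2)/(F8), that for an X9 pair `(E, p)` the `p`-division field and
the cyclotomic `ℤ_p`-extension are linearly disjoint — `ℚ(E[p]) ∩ ℚ_∞ = ℚ`, "`G ↠ Ḡ × Γ_e`" — because
`p ∤ #Ḡ`, `Ḡ = ρ̄_{E,p}(Γ_ℚ)` (Serre 1972 Prop. 15: `E[p]` irreducible, `ρ̄` not onto, `det` onto).
The landed kernel step `LevelE.modPTwist_stable_addSubgroup_eq_tPow` (seat k6-c2, p432130;
MU-TRANSFER-PROOF §4 Lemma 3 (i) on the genuine modules `𝒯_J(E)`) carries exactly this input as the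
two hypotheses `(hγ₀ : κ.IsTopGenerator γ₀) (hγ₀E : ∀ P : E[p], γ₀ • P = P)` — "some topological
generator of `κ` acts trivially on `E[p]`" — whose discharge on X9 its docstring defers ("exists
whenever `F(E[p]) ∩ F_∞ = F`, e.g. `p ∤ #ρ̄(Γ_F)` — the X9 images").  This file IS that discharge:

* `ZpImage.map_eq_top_of_coprime_index` — pure group theory: for `f : G →* ℤ_p` onto and
  `H ≤ G` of index prime to `p`, `f(H) = ℤ_p` (the index of `f(H)` divides `[G : H]`; `m`-th powers
  lie in a subgroup of index `m`; an `m` prime to `p` is a unit of `ℤ_p`).  Corollaries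
  `ZpImage.exists_mem_and_eq`, `ZpImage.exists_ker_eq_and_eq` (joint surjectivity with a second
  homomorphism `g` whose kernel has index prime to `p`), `ZpImage.ker_sup_ker_eq_top`.
* For ANY field `F`, curve `W/F` and `κ : ZpExtension F p` with `p ∤ #ρ̄_{W,p}(Γ_F)`
  (`Nat.card (galoisRepTorsion W p).range`): `map_ker_galoisRepTorsion_eq_top`
  (`κ(ker ρ̄) = ℤ_p`), `exists_galoisRepTorsion_eq_and_eq` (`∀ τ y, ∃ σ, ρ̄ σ = ρ̄ τ ∧ κ σ = y`:
  `(ρ̄, κ) : Γ_F ↠ Ḡ × ℤ_p`, i.e. `F(E[p]) ∩ F_∞ = F`), `ker_galoisRepTorsion_sup_layerSubgroup_eq_top`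
  (`Γ_F = ker ρ̄ · Γ_{F_n}`: "`G ↠ Ḡ × Γ_e`" at every finite layer),
  `exists_isTopGenerator_galoisRepTorsion_eq_one` / `exists_isTopGenerator_forall_smul_eq`
  (**a topological generator `γ₀` of `κ` with `ρ̄(γ₀) = 1`** — the p432130 hypotheses verbatim).
* Over `ℚ` from `E[p]` irreducible and `ρ̄_{E,p}` not onto at ANY prime `p` (Serre Prop. 15 through
  the tree's `not_dvd_card_of_not_hasSurjectiveModNGaloisRep` and the frame
  `exists_frame_galoisRepTorsion_rat`; the `p = 3` twin class X10b∧¬Surj included):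
  `not_dvd_card_range_galoisRepTorsion_of_irreducible_of_not_surjective` and the same four
  conclusions `…_of_irreducible_of_not_surjective`.
* On class X9 (`Rank1Residual.ClassX9 W p`: non-CM, `p ≥ 5` good ordinary, `E[p]` irreducible, `ρ̄`
  not onto), for EVERY `κ : ZpExtension ℚ p`: `ClassX9.not_dvd_card_range_galoisRepTorsion`,
  `ClassX9.map_ker_galoisRepTorsion_eq_top`, `ClassX9.exists_galoisRepTorsion_eq_and_eq`,
  `ClassX9.ker_galoisRepTorsion_sup_layerSubgroup_eq_top`,
  **`ClassX9.exists_isTopGenerator_forall_smul_eq`**.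

No topology is used: the argument is the index computation `[ℤ_p : κ(ker ρ̄)] ∣ #Ḡ`, prime to `p`,
while every finite-index subgroup of `ℤ_p` has `p`-power index.  Relation to the k6-c2 append of
p432130's file (`modPTwist_stable_addSubgroup_eq_tPow_of_unit`, `exists_fixing_twistExponent_not_dvd`:
the hypothesis weakened to "some `σ₀` fixing `E[p]` has `κ(σ₀) mod p^J` prime to `p`", met by
`σ₀ = γ^m`, `m` an exponent of `Ḡ` prime to `p`, for `J ≥ 1`): complementary — here the ORIGINAL
hypothesis (a genuine topological generator inside `ker ρ̄`) is met, at every `J`, with no exponent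
bookkeeping, and the lattice / joint-surjectivity forms of (F8) are recorded.  (X9 prover GEN 41,
2026-08-26.)

## References

* [Serre1972] J.-P. Serre, *Propriétés galoisiennes des points d'ordre fini des courbes
  elliptiques*, Invent. Math. 15 (1972) 259–331: §2.4 Prop. 15; §5.4, proof of Prop. 21, first lines.
* [Washington1997] L. C. Washington, *Introduction to Cyclotomic Fields*, 2nd ed., GTM 83,
  Springer 1997: §13.1 (`ℤ_p`-extensions, `Gal(K_∞/K) ≅ ℤ_p`, layers of index `pⁿ`), §13.2 (`γ`).
* `HOME/koly/MU-TRANSFER-PROOF.md` (cell bsd-smallim) §2 (F2), (F8); §4 Lemma 3 (i).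
-/

-- the summit and its single problem are both named `BirchSwinnertonDyer` (registry layout D-0017)
set_option linter.dupNamespace false

set_option autoImplicit false

noncomputable section

open Field WeierstrassCurve Literature.NumberTheory.EllipticCurves

namespace Summit.BirchSwinnertonDyer.BirchSwinnertonDyer.Rank1Residual

/-! ### Group theory: a subgroup of index prime to `p` maps ONTO `ℤ_p` -/

namespace ZpImage

universe v w

variable {G : Type v} [Group G] {p : ℕ} [Fact p.Prime]

/-- If every `m`-th power of `ℤ_p` (written multiplicatively) lies in the subgroup `A`, for an `m`
prime to `p`, then `A` is everything: `m` is a unit of `ℤ_p`, so `z = m • (m⁻¹ z)` is an `m`-th power.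
[cite: Washington1997, §13.1] -/
theorem ofAdd_mem_of_forall_pow_mem (A : Subgroup (Multiplicative ℤ_[p])) {m : ℕ}
    (hm : p.Coprime m) (hA : ∀ y : Multiplicative ℤ_[p], y ^ m ∈ A) (z : ℤ_[p]) :
    Multiplicative.ofAdd z ∈ A := by
  obtain ⟨u, hu⟩ : IsUnit (m : ℤ_[p]) :=
    PadicInt.isUnit_iff.mpr (PadicInt.norm_natCast_eq_one_iff.mpr hm)
  have hz : Multiplicative.ofAdd z = Multiplicative.ofAdd ((↑u⁻¹ : ℤ_[p]) * z) ^ m := by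
    rw [← ofAdd_nsmul, nsmul_eq_mul, ← mul_assoc, ← hu, Units.mul_inv, one_mul]
  rw [hz]
  exact hA _

/-- **A subgroup of `ℤ_p` of index prime to `p` is `ℤ_p`** (every finite-index subgroup of `ℤ_p`
is `pⁿ ℤ_p`, of index `pⁿ`): `m`-th powers lie in a subgroup of index `m`
(`Subgroup.pow_index_mem`), and `ofAdd_mem_of_forall_pow_mem`. [cite: Washington1997, §13.1] -/
theorem eq_top_of_coprime_index (A : Subgroup (Multiplicative ℤ_[p])) (hA : p.Coprime A.index) :
    A = ⊤ := by
  rw [Subgroup.eq_top_iff']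
  intro x
  exact ofAdd_mem_of_forall_pow_mem A hA (fun y ↦ A.pow_index_mem y) (Multiplicative.toAdd x)

/-- **A subgroup `H ≤ G` of index prime to `p` maps ONTO `ℤ_p`** under any surjection
`f : G ↠ ℤ_p`: `[ℤ_p : f(H)]` divides `[G : H]` (`Subgroup.index_map_dvd`), so it is prime to
`p`, and `eq_top_of_coprime_index`.  (With `G = Γ_ℚ`, `f = κ_cyc`, `H = Gal(ℚ̄/ℚ(E[p]))`:
`ℚ(E[p]) ∩ ℚ_∞ = ℚ` as soon as `p ∤ [ℚ(E[p]) : ℚ]`.) [cite: Washington1997, §13.1] -/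
theorem map_eq_top_of_coprime_index (f : G →* Multiplicative ℤ_[p])
    (hf : Function.Surjective f) (H : Subgroup G) (hH : p.Coprime H.index) :
    H.map f = ⊤ :=
  eq_top_of_coprime_index _ (Nat.Coprime.coprime_dvd_right (H.index_map_dvd hf) hH)

/-- Element form of `map_eq_top_of_coprime_index`: every `y ∈ ℤ_p` is `f h` for some `h ∈ H`.
[cite: Washington1997, §13.1] -/
theorem exists_mem_and_eq (f : G →* Multiplicative ℤ_[p]) (hf : Function.Surjective f)
    (H : Subgroup G) (hH : p.Coprime H.index) (y : Multiplicative ℤ_[p]) :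
    ∃ h ∈ H, f h = y := by
  rw [← Subgroup.mem_map, map_eq_top_of_coprime_index f hf H hH]
  exact Subgroup.mem_top y

/-- **Joint surjectivity `(g, f) : G ↠ g(G) × ℤ_p`** when `ker g` has index prime to `p`
(i.e. `#g(G)` is finite and prime to `p`) and `f : G ↠ ℤ_p`: for every `τ ∈ G` and `y ∈ ℤ_p`
some `σ` has `g σ = g τ` and `f σ = y` (take `σ = τ h`, `h ∈ ker g`, `f h = (f τ)⁻¹ y`).
[cite: Washington1997, §13.1] -/
theorem exists_ker_eq_and_eq {M : Type w} [Group M] (g : G →* M)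
    (f : G →* Multiplicative ℤ_[p]) (hf : Function.Surjective f) (hH : p.Coprime g.ker.index)
    (τ : G) (y : Multiplicative ℤ_[p]) : ∃ σ : G, g σ = g τ ∧ f σ = y := by
  obtain ⟨h, hh, hfh⟩ := exists_mem_and_eq f hf g.ker hH ((f τ)⁻¹ * y)
  refine ⟨τ * h, ?_, ?_⟩
  · rw [map_mul, MonoidHom.mem_ker.mp hh, mul_one]
  · rw [map_mul, hfh, mul_inv_cancel_left]

/-- Lattice form: `ker g ⊔ K = ⊤` for every subgroup `K ⊇ ker f` (e.g. `K = f⁻¹(pⁿ ℤ_p)`), when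
`ker g` has index prime to `p` and `f : G ↠ ℤ_p` — "`G ↠ g(G) × G/K`". [cite: Washington1997, §13.1] -/
theorem ker_sup_eq_top_of_ker_le {M : Type w} [Group M] (g : G →* M)
    (f : G →* Multiplicative ℤ_[p]) (hf : Function.Surjective f) (hH : p.Coprime g.ker.index)
    (K : Subgroup G) (hK : f.ker ≤ K) : g.ker ⊔ K = ⊤ := by
  rw [Subgroup.eq_top_iff']
  intro x
  obtain ⟨h, hh, hfh⟩ := exists_mem_and_eq f hf g.ker hH (f x)
  have hx : x = h * (h⁻¹ * x) := by rw [mul_inv_cancel_left]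
  rw [hx]
  refine Subgroup.mul_mem_sup hh (hK ?_)
  rw [MonoidHom.mem_ker, map_mul, map_inv, hfh, inv_mul_cancel]

end ZpImage

/-! ### Any field: `p ∤ #ρ̄_{W,p}(Γ_F)` ⟹ `F(E[p])` and every `ℤ_p`-extension are disjoint -/

section AnyField

universe u

variable {F : Type u} [Field F] (W : WeierstrassCurve F) (p : ℕ) [Fact p.Prime]
  (κ : ZpExtension F p)

/-- The index of `ker ρ̄_{W,p} = Gal(F̄/F(E[p]))` in `Γ_F` is `#ρ̄_{W,p}(Γ_F)`; so it is prime to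
`p` iff `p ∤ #ρ̄_{W,p}(Γ_F)`. [cite: Serre1972, §2.4 Prop. 15] -/
theorem coprime_index_ker_galoisRepTorsion
    (hG : ¬ p ∣ Nat.card (galoisRepTorsion W p).range) :
    p.Coprime (galoisRepTorsion W p).ker.index := by
  rw [Subgroup.index_ker]
  exact (Nat.Prime.coprime_iff_not_dvd Fact.out).mpr hG

/-- **`κ(Gal(F̄/F(E[p]))) = ℤ_p`** for every `ℤ_p`-extension `κ` of `F`, as soon as
`p ∤ #ρ̄_{W,p}(Γ_F)`: the `p`-division field of `E` and `F_∞` are linearly disjoint over `F`.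
[cite: Washington1997, §13.1] [cite: Serre1972, §2.4 Prop. 15] -/
theorem map_ker_galoisRepTorsion_eq_top (hG : ¬ p ∣ Nat.card (galoisRepTorsion W p).range) :
    (galoisRepTorsion W p).ker.map κ.toContinuousMonoidHom.toMonoidHom = ⊤ :=
  ZpImage.map_eq_top_of_coprime_index _ κ.surjective _
    (coprime_index_ker_galoisRepTorsion W p hG)

/-- **`(ρ̄_{W,p}, κ) : Γ_F ↠ ρ̄(Γ_F) × ℤ_p`** (joint surjectivity; "`F(E[p]) ∩ F_∞ = F`"), as soon
as `p ∤ #ρ̄_{W,p}(Γ_F)`: for every `τ ∈ Γ_F` and `y ∈ ℤ_p` some `σ ∈ Γ_F` acts on `E[p]` as `τ`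
does and has `κ σ = y`. [cite: Washington1997, §13.1] [cite: Serre1972, §2.4 Prop. 15] -/
theorem exists_galoisRepTorsion_eq_and_eq (hG : ¬ p ∣ Nat.card (galoisRepTorsion W p).range)
    (τ : absoluteGaloisGroup F) (y : Multiplicative ℤ_[p]) :
    ∃ σ : absoluteGaloisGroup F,
      galoisRepTorsion W p σ = galoisRepTorsion W p τ ∧ κ σ = y :=
  ZpImage.exists_ker_eq_and_eq (galoisRepTorsion W p) κ.toContinuousMonoidHom.toMonoidHom
    κ.surjective (coprime_index_ker_galoisRepTorsion W p hG) τ y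

/-- **"`G ↠ Ḡ × Γ_e`" at every finite layer** (MU-TRANSFER-PROOF (F8)): `Γ_F` is generated by
`ker ρ̄_{W,p}` and `Gal(F̄/F_n) = κ⁻¹(pⁿ ℤ_p)` (`ZpExtension.layerSubgroup`), as soon as
`p ∤ #ρ̄_{W,p}(Γ_F)`. [cite: Washington1997, §13.1] [cite: Serre1972, §2.4 Prop. 15] -/
theorem ker_galoisRepTorsion_sup_layerSubgroup_eq_top
    (hG : ¬ p ∣ Nat.card (galoisRepTorsion W p).range) (n : ℕ) :
    (galoisRepTorsion W p).ker ⊔ κ.layerSubgroup n = ⊤ :=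
  ZpImage.ker_sup_eq_top_of_ker_le (galoisRepTorsion W p) κ.toContinuousMonoidHom.toMonoidHom
    κ.surjective (coprime_index_ker_galoisRepTorsion W p hG) _ (κ.kerSubgroup_le_layerSubgroup n)

/-- **"`G ↠ Ḡ × Γ`"**: `Γ_F` is generated by `ker ρ̄_{W,p}` and `Gal(F̄/F_∞) = ker κ`, as soon as
`p ∤ #ρ̄_{W,p}(Γ_F)`. [cite: Washington1997, §13.1] [cite: Serre1972, §2.4 Prop. 15] -/
theorem ker_galoisRepTorsion_sup_kerSubgroup_eq_top
    (hG : ¬ p ∣ Nat.card (galoisRepTorsion W p).range) :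
    (galoisRepTorsion W p).ker ⊔ κ.kerSubgroup = ⊤ :=
  ZpImage.ker_sup_eq_top_of_ker_le (galoisRepTorsion W p) κ.toContinuousMonoidHom.toMonoidHom
    κ.surjective (coprime_index_ker_galoisRepTorsion W p hG) _ le_rfl

/-- **A topological generator of `κ` in `ker ρ̄_{W,p}`**: if `p ∤ #ρ̄_{W,p}(Γ_F)` then some
`γ₀ ∈ Γ_F` has `κ γ₀ = 1 ∈ ℤ_p` (`ZpExtension.IsTopGenerator`) and `ρ̄_{W,p}(γ₀) = 1`.
[cite: Washington1997, §13.1–§13.2] [cite: Serre1972, §2.4 Prop. 15] -/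
theorem exists_isTopGenerator_galoisRepTorsion_eq_one
    (hG : ¬ p ∣ Nat.card (galoisRepTorsion W p).range) :
    ∃ γ₀ : absoluteGaloisGroup F, κ.IsTopGenerator γ₀ ∧ galoisRepTorsion W p γ₀ = 1 := by
  obtain ⟨σ, h1, h2⟩ :=
    exists_galoisRepTorsion_eq_and_eq W p κ hG 1 (Multiplicative.ofAdd 1)
  exact ⟨σ, h2, by rw [h1, map_one]⟩

/-- **A topological generator of `κ` FIXING `E[p]` pointwise** — exactly the hypotheses
`(hγ₀ : κ.IsTopGenerator γ₀) (hγ₀E : ∀ P : E[p], γ₀ • P = P)` of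
`LevelE.modPTwist_stable_addSubgroup_eq_tPow` (p432130) — as soon as `p ∤ #ρ̄_{W,p}(Γ_F)`.
[cite: Washington1997, §13.1–§13.2] [cite: Serre1972, §2.4 Prop. 15] -/
theorem exists_isTopGenerator_forall_smul_eq
    (hG : ¬ p ∣ Nat.card (galoisRepTorsion W p).range) :
    ∃ γ₀ : absoluteGaloisGroup F, κ.IsTopGenerator γ₀ ∧
      ∀ P : geomTorsion W p, γ₀ • P = P := by
  obtain ⟨γ₀, hγ₀, h1⟩ := exists_isTopGenerator_galoisRepTorsion_eq_one W p κ hG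
  refine ⟨γ₀, hγ₀, fun P ↦ ?_⟩
  rw [← galoisRepTorsion_apply, h1]
  rfl

end AnyField

/-! ### Over `ℚ`: `E[p]` irreducible and `ρ̄_{E,p}` not onto ⟹ `p ∤ #Ḡ` (Serre Prop. 15) -/

section Rat

variable (W : WeierstrassCurve ℚ) [W.IsElliptic] (p : ℕ) [Fact p.Prime] (κ : ZpExtension ℚ p)

/-- **`p ∤ #ρ̄_{E,p}(Γ_ℚ)`** for `E/ℚ` with `E[p]` irreducible and `ρ̄_{E,p}` NOT onto, at any
prime `p` (Serre 1972 Prop. 15 with `det` onto: a subgroup of `GL₂(𝔽_p)` of order divisible by `p`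
is Borel or contains `SL₂(𝔽_p)`), frame-free — the tree's
`not_dvd_card_of_not_hasSurjectiveModNGaloisRep` in a frame `exists_frame_galoisRepTorsion_rat`,
transported by `card_map_range_galoisRepTorsion` (same three lines as the cell's
`smallImage_not_dvd_card_image` for class X7, restated to keep this file's imports on its own route).
[cite: Serre1972, §2.4 Prop. 15; §5.4, proof of Prop. 21, first lines] -/
theorem not_dvd_card_range_galoisRepTorsion_of_irreducible_of_not_surjective
    (hirr : W.HasIrreducibleModPGaloisRep p) (hns : ¬ W.HasSurjectiveModNGaloisRep p) :
    ¬ p ∣ Nat.card (galoisRepTorsion W p).range := by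
  obtain ⟨e, Φ, he, -⟩ := exists_frame_galoisRepTorsion_rat W p
  rw [← card_map_range_galoisRepTorsion W p Φ]
  exact not_dvd_card_of_not_hasSurjectiveModNGaloisRep W p Φ e he hirr hns

/-- **`(ρ̄_{E,p}, κ) : Γ_ℚ ↠ Ḡ × ℤ_p`** ("`ℚ(E[p]) ∩ ℚ_∞ = ℚ`", MU-TRANSFER-PROOF (F2)) for `E/ℚ`
with `E[p]` irreducible and `ρ̄_{E,p}` not onto, every `ℤ_p`-extension `κ` of `ℚ`, any prime `p`.
[cite: Serre1972, §2.4 Prop. 15] [cite: Washington1997, §13.1] -/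
theorem exists_galoisRepTorsion_eq_and_eq_of_irreducible_of_not_surjective
    (hirr : W.HasIrreducibleModPGaloisRep p) (hns : ¬ W.HasSurjectiveModNGaloisRep p)
    (τ : absoluteGaloisGroup ℚ) (y : Multiplicative ℤ_[p]) :
    ∃ σ : absoluteGaloisGroup ℚ,
      galoisRepTorsion W p σ = galoisRepTorsion W p τ ∧ κ σ = y :=
  exists_galoisRepTorsion_eq_and_eq W p κ
    (not_dvd_card_range_galoisRepTorsion_of_irreducible_of_not_surjective W p hirr hns) τ y

/-- **"`G ↠ Ḡ × Γ_e`"** (MU-TRANSFER-PROOF (F8)) for `E/ℚ` with `E[p]` irreducible and `ρ̄_{E,p}`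
not onto: `Γ_ℚ = ker ρ̄_{E,p} · Gal(ℚ̄/ℚ_n)` at every layer `n`. [cite: Serre1972, §2.4 Prop. 15]
[cite: Washington1997, §13.1] -/
theorem ker_galoisRepTorsion_sup_layerSubgroup_eq_top_of_irreducible_of_not_surjective
    (hirr : W.HasIrreducibleModPGaloisRep p) (hns : ¬ W.HasSurjectiveModNGaloisRep p) (n : ℕ) :
    (galoisRepTorsion W p).ker ⊔ κ.layerSubgroup n = ⊤ :=
  ker_galoisRepTorsion_sup_layerSubgroup_eq_top W p κ
    (not_dvd_card_range_galoisRepTorsion_of_irreducible_of_not_surjective W p hirr hns) n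

/-- **A topological generator of `κ` fixing `E[p]`** for `E/ℚ` with `E[p]` irreducible and
`ρ̄_{E,p}` not onto (any prime `p`; the `p = 3` twin class X10b∧¬Surj included).
[cite: Serre1972, §2.4 Prop. 15] [cite: Washington1997, §13.2] -/
theorem exists_isTopGenerator_forall_smul_eq_of_irreducible_of_not_surjective
    (hirr : W.HasIrreducibleModPGaloisRep p) (hns : ¬ W.HasSurjectiveModNGaloisRep p) :
    ∃ γ₀ : absoluteGaloisGroup ℚ, κ.IsTopGenerator γ₀ ∧
      ∀ P : geomTorsion W p, γ₀ • P = P :=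
  exists_isTopGenerator_forall_smul_eq W p κ
    (not_dvd_card_range_galoisRepTorsion_of_irreducible_of_not_surjective W p hirr hns)

/-! ### Class X9 -/

variable [W.IsGloballyMinimal]

/-- **On class X9, `p ∤ #ρ̄_{E,p}(Γ_ℚ)`** (`ClassX9`: `E[p]` irreducible, `ρ̄_{E,p}` not onto;
Serre Prop. 15). [cite: Serre1972, §2.4 Prop. 15] -/
theorem ClassX9.not_dvd_card_range_galoisRepTorsion (h : ClassX9 W p) :
    ¬ p ∣ Nat.card (galoisRepTorsion W p).range :=
  not_dvd_card_range_galoisRepTorsion_of_irreducible_of_not_surjective W p h.2.2.2.2.1 h.2.2.2.2.2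

/-- **On class X9, `κ(Gal(ℚ̄/ℚ(E[p]))) = ℤ_p`** for every `ℤ_p`-extension `κ` of `ℚ`
(`ℚ(E[p]) ∩ ℚ_∞ = ℚ`, MU-TRANSFER-PROOF (F2)). [cite: Serre1972, §2.4 Prop. 15]
[cite: Washington1997, §13.1] -/
theorem ClassX9.map_ker_galoisRepTorsion_eq_top (h : ClassX9 W p) :
    (galoisRepTorsion W p).ker.map κ.toContinuousMonoidHom.toMonoidHom = ⊤ :=
  Rank1Residual.map_ker_galoisRepTorsion_eq_top W p κ
    (ClassX9.not_dvd_card_range_galoisRepTorsion W p h)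

/-- **On class X9, `(ρ̄_{E,p}, κ) : Γ_ℚ ↠ Ḡ × ℤ_p`**: for every `τ ∈ Γ_ℚ` and `y ∈ ℤ_p` some
`σ ∈ Γ_ℚ` acts on `E[p]` as `τ` and has `κ σ = y` (MU-TRANSFER-PROOF (F2)/(F8)).
[cite: Serre1972, §2.4 Prop. 15] [cite: Washington1997, §13.1] -/
theorem ClassX9.exists_galoisRepTorsion_eq_and_eq (h : ClassX9 W p)
    (τ : absoluteGaloisGroup ℚ) (y : Multiplicative ℤ_[p]) :
    ∃ σ : absoluteGaloisGroup ℚ,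
      galoisRepTorsion W p σ = galoisRepTorsion W p τ ∧ κ σ = y :=
  Rank1Residual.exists_galoisRepTorsion_eq_and_eq W p κ
    (ClassX9.not_dvd_card_range_galoisRepTorsion W p h) τ y

/-- **On class X9, "`G ↠ Ḡ × Γ_e`"**: `Γ_ℚ = ker ρ̄_{E,p} · Gal(ℚ̄/ℚ_n)` at every layer `n` of
every `ℤ_p`-extension of `ℚ` (MU-TRANSFER-PROOF (F8)). [cite: Serre1972, §2.4 Prop. 15]
[cite: Washington1997, §13.1] -/
theorem ClassX9.ker_galoisRepTorsion_sup_layerSubgroup_eq_top (h : ClassX9 W p) (n : ℕ) :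
    (galoisRepTorsion W p).ker ⊔ κ.layerSubgroup n = ⊤ :=
  Rank1Residual.ker_galoisRepTorsion_sup_layerSubgroup_eq_top W p κ
    (ClassX9.not_dvd_card_range_galoisRepTorsion W p h) n

/-- **On class X9, a topological generator `γ₀` of ANY `ℤ_p`-extension `κ` of `ℚ` FIXES `E[p]`
pointwise** — the hypotheses `(κ.IsTopGenerator γ₀, ∀ P : E[p], γ₀ • P = P)` of the K6 kernel step
`LevelE.modPTwist_stable_addSubgroup_eq_tPow` (p432130; MU-TRANSFER-PROOF §4 Lemma 3 (i)),
DISCHARGED on the class of crux `MuTransferX9`. [cite: Serre1972, §2.4 Prop. 15]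
[cite: Washington1997, §13.1–§13.2] -/
theorem ClassX9.exists_isTopGenerator_forall_smul_eq (h : ClassX9 W p) :
    ∃ γ₀ : absoluteGaloisGroup ℚ, κ.IsTopGenerator γ₀ ∧
      ∀ P : geomTorsion W p, γ₀ • P = P :=
  Rank1Residual.exists_isTopGenerator_forall_smul_eq W p κ
    (ClassX9.not_dvd_card_range_galoisRepTorsion W p h)

end Rat

end Summit.BirchSwinnertonDyer.BirchSwinnertonDyer.Rank1Residual

end
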